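import Literature.AnabelianGeometry.EtaleTheta.ArithThetaTowerFrobenioidPull
import Literature.AlgebraicGeometry.Frobenioids.ArithmeticFrobenioidNonDilating
import HarnessLib

/-!
# [IUTchI] Ex. 3.2 (iii) / [EtTh] Cor. 3.8 (ii) at the ARITHMETIC theta tower: the divisor monoid `Φ` of the
# carrier is NON-DILATING (`hnd`) — GAP A item GA-08 (D8, part 1)

S. Mochizuki, *The étale theta function …*, Publ. RIMS **45** (2009) [MochizukiEtTh2009], Def. 3.6 (ii) pp.76–77,
Thm. 3.7 (ii) p.79, Cor. 3.8 (ii) pp.80–81; *The geometry of Frobenioids I*, Kyushu J. Math. **62** (2008)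
[MochizukiFrdI2008], §0 p.12 (primary elements, `≼`), Def. 1.1 (i)/(ii) p.19 («non-dilating»: the endomorphism
`α^char` of `Φ(A)^char` is the identity as soon as `α^char(a) ≼ a` for every primary `a`); *Inter-universal
Teichmüller Theory I* [Mochizuki2012], Ex. 3.2 (iii) p.71 [cite: MochizukiEtTh2009, Cor 3.8 p.80].

GAP A of record G-L5-EX32I-1 (abc-iut cell), row GA-08 = D8 part 1 of GAP-SIZING-A.md 69de97346848d3e8; ruled shape
`plan/L5/GAP-A-SIGNATURES.md` v1 e3ccddf9b87597cf §5 as amended by RULINGS #339 (2)/(3) (a countersigned SIG-DELTA on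
D8 only): the `hnd` instance hypothesis of [EtTh] Cor. 3.8 (ii) — «`Φ` non-dilating» — is stated over the BINDERS
`(C : TemperedFrobenioid T' T.Dv VD) (hC : CarrierSpec d T C)` (S0, `ArithThetaTowerFrobenioid.lean`) and the
index-free PULL DICHOTOMY `(hD : CarrierSpec.PullDichotomy C)` («along every endomorphism `f` of an object `A` of
`𝒟_v̲ = CosetCat Π_v̲` the pull-back `Φ(f)` is EITHER the identity of `Φ(A)` OR carries some PRIMARY element off
itself»), and proved AT EVERY OBJECT, with NO finite-index hypothesis.  What is here (PROOF-ONLY: theorems, no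
definition, no instance, no notation):

* **`ArithThetaTower.isNonDilating_of_carrierSpec (hC) (hD) : ∀ (A : T.Dvᵒᵖ) (f : A ⟶ A),
  treeMonoidVocabWeak.IsNonDilating (C.Φ.carrier A) (C.Φ.pull f)`** — D8 as ruled; the result type is verbatim the
  `hnd` binder of `BadLocalFrobenioid.cFromF_ofKits_toInput` ([IUTchI] Ex. 3.2 (iii) consumers).  ROUTE OF RECORD
  (#339 (2)): case on `hD A f` — identity branch ⇒ `Φ(f) = id`; witness branch ⇒ the dilation premise «`Φ(f)(a) ≼ a`
  for every primary `a`» fails at the witness; sharpness of `Φ(A)` is Def. 3.6 (ii) "perf-factorial" read in the weak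
  vocabulary (`IsPerfFactorialCof` ⇒ divisorial ⇒ sharp, `TemperedFrobenioid.isSharp_carrier_treeMonoidVocabWeak`);
  closer `isNonDilating_of_forall_isPrimary` ([FrdI] Thm. 6.4 (i) pattern) packaged as GA-04's
  `CarrierSpec.PullDichotomy.isNonDilating_pull` (`ArithThetaTowerFrobenioidPull.lean`), used BY NAME.  Under #339 (3)
  the dichotomy `hD` carries the whole lever; the S0 binder is kept as ruled (spelled `_hC` in the source: it is
  logically idle in this one theorem).
* `isNonDilatingOn_divisorMonoid_of_carrierSpec` — the same in the functorial form `IsNonDilatingOn Φ` of [FrdI]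
  Def. 1.1 (ii) (the `hnd` of the `Cor53iv*` / `opsData_isOfStandardType_*` consumers);
  `isOfStandardType_of_carrierSpec` — [EtTh] Thm. 3.7 (ii), first clause, AT THE CARRIER: `𝒟_v̲` is of FSMFF-type
  (`BadLocalFrobenioid.isOfFSMFFType_Dv`) and `Φ` is non-dilating, so `C` is of standard type ([FrdI] Def. 3.1 (i)).
* **`ArithThetaTower.CarrierSpec.pullDichotomy_of_lattice (hC) (h) : CarrierSpec.PullDichotomy C`** — the TRANSPORT
  that uses S0 genuinely: by `hC.Φ_carrier`, `Φ(A)` is the perf-saturation of the image of the LATTICE map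
  `Φ₀(Y_A) → Φ₀^ℝ(Y_A)`, and `Φ₀^ℝ(Y_A) ≅ Φ₀(Y_A)^rlf` compatibly (`T'.isRealification`, weak vocabulary), so
  `Ψ : Φ₀(Y_A)^pf ≃* Φ(A)` with `Ψ(a) = ι(a)` and `Φ(f) ∘ Ψ = Ψ ∘ Φ₀(Y_f)^pf`; a dichotomy «identity, or a primary
  carried off itself» for the LATTICE pull-back `Φ₀(Y_f)` therefore yields the carrier-level `PullDichotomy`
  (primaries by `Perfection.isPrimary_of_iff` / `IsPrimary.map_mulEquiv`, `≼` reflected by `precsim_map_iff` /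
  `Perfection.of_precsim_of_iff`, the identity branch by unique roots in `Φ₀(Y_A)^pf`) — the pattern of
  `TemperedFrobenioid.DiagonalBase.isNonDilating_pull_of_dichotomy` (`BiKummerThm44HypOfGaloisCoveringZTowerAll.lean`)
  lifted off the engines to ANY carrier satisfying S0; stated over `C.baseOp A` / `C.base.map f.unop`, so that at a
  term with `C.base = 𝟭 T.Dv` definitionally (GA-12's `temperedFrobenioid d T`) the hypothesis `h` IS the lattice
  dichotomy on `Φ₀` as computed there (RULINGS #339 (1): `U`-orbits under `gU ↦ g·n·U`, witness `(e_O, 0)`);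
  `isNonDilating_of_carrierSpec_of_lattice` composes the two; `isPrimary_one_prod` / `latticeDichotomy_prod_of_snd`
  push a dichotomy on the geometric factor through the product lattice `ord × Div⁺` of the term (constants first,
  `divisorMonoidsOf_Φ₀_obj`; the `ord`-coordinate of every pull along an endomorphism is the identity).

HONEST FRAMING: elementary monoid algebra at OUR typed objects; the H+ branch of `hnd` AT the carrier is CONDITIONAL on
the dichotomy `hD` (inhabited at the term by GA-12's `pullDichotomy_temperedFrobenioid`, not here); typed ≠ inhabited
≠ proved-in-print; an UNDISPUTED construction around [IUTchIII] Cor. 3.12, which stays OPEN by charter (D-0045) — no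
side is taken on it or on any author; nothing here asserts the abc conjecture proved or refuted; count-neutral.
No definition, no instance, no notation, no attribute manipulation, no `sorry`.
-/

namespace Literature.AnabelianGeometry.EtaleTheta

namespace ArithThetaTower

open CategoryTheory Opposite Function Literature.AlgebraicGeometry.Frobenioids Literature.IUT.HodgeTheaters

variable {p : ℕ} [Fact p.Prime] {d : GaloisValDatum.{0} p} {P : Type} [Group P] [TopologicalSpace P]
  {T : BadLocalGroupDatum d.Gal P} {T' : RealifiedDivisorMonoids (D₀ := T.Dv) treeMonoidVocabWeak.{0}}
  {VD : FrdICatStub.{0, 0, 0} T.Dv} {C : TemperedFrobenioid T' T.Dv VD}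

/-! ## D8 — `Φ` is non-dilating at every object, from the pull dichotomy -/

/-- **D8 (GAP A item GA-08): the divisor monoid `Φ` of a carrier satisfying S0 is NON-DILATING along every
endomorphism of every object of `𝒟_v̲`** ([FrdI] Def. 1.1 (i): `Φ(f)^char = id` as soon as `Φ(f)^char(a) ≼ a` for every
primary `a ∈ Φ(A)^char`) — the `hnd` instance hypothesis of [EtTh] Cor. 3.8 (ii) at the carrier, AT EVERY OBJECT, with
no finite-index hypothesis (RULINGS #339 (2)/(3)).  From the pull dichotomy `hD A f` (GA-04's lever
`CarrierSpec.PullDichotomy.isNonDilating_pull` BY NAME): in the identity branch `Φ(f)` is the identity; in the witness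
branch the dilation premise fails at the primary witness; `Φ(A)` is sharp because it is perf-factorial in the weak
vocabulary (Def. 3.6 (ii)).  The S0 binder `hC` is part of the ruled signature (§5 D8) and is not used by this proof
(spelled `_hC`, typer's call t1, keeper-endorsed). [cite: MochizukiEtTh2009, Cor 3.8 (ii) p.80] -/
theorem isNonDilating_of_carrierSpec (_hC : CarrierSpec d T C) (hD : CarrierSpec.PullDichotomy C) :
    ∀ (A : T.Dvᵒᵖ) (f : A ⟶ A), treeMonoidVocabWeak.IsNonDilating (C.Φ.carrier A) (C.Φ.pull f) :=
  fun A f => hD.isNonDilating_pull A f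

/-- **`Φ` is non-dilating in the functorial form of [FrdI] Def. 1.1 (ii)** (`IsNonDilatingOn Φ`: the pull-back along
every endomorphism of every object of `𝒟_v̲` is a non-dilating endomorphism of `Φ(A)`) — the shape consumed by the
tree's `opsData_isOfStandardType_*` / `Cor53iv*` statements. [cite: MochizukiFrdI2008, Def. 1.1 (ii) p.19] -/
theorem isNonDilatingOn_divisorMonoid_of_carrierSpec (hC : CarrierSpec d T C) (hD : CarrierSpec.PullDichotomy C) :
    IsNonDilatingOn C.divisorMonoid :=
  C.isNonDilatingOn_iff_pull_weak.2 (isNonDilating_of_carrierSpec hC hD)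

/-- **[EtTh] Thm. 3.7 (ii), first clause, AT THE CARRIER**: "Suppose `D` is of FSMFF-type, and that `Φ` is
non-dilating. Then `C` is of standard type" — `𝒟_v̲ = CosetCat Π_v̲` is of FSMFF-type
(`BadLocalFrobenioid.isOfFSMFFType_Dv`) and `Φ` is non-dilating (`isNonDilating_of_carrierSpec`), so the carrier is of
standard type in the sense of [FrdI] Def. 3.1 (i) (`PreFrobenioidData.IsOfStandardType` at `C.opsData`).
[cite: MochizukiEtTh2009, Thm 3.7 (ii) p.79] -/
theorem isOfStandardType_of_carrierSpec [IsTopologicalGroup P] (hC : CarrierSpec d T C)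
    (hD : CarrierSpec.PullDichotomy C) : C.opsData.IsOfStandardType :=
  C.opsData_isOfStandardType_treeMonoidVocabWeak_of_forall_pull (BadLocalFrobenioid.isOfFSMFFType_Dv d T)
    (isNonDilating_of_carrierSpec hC hD)

/-! ## The lattice → carrier transport of the dichotomy (uses S0: `Φ_carrier` + the realification structure) -/

namespace CarrierSpec

/-- Membership in `Φ(A)` under S0: `x ∈ Φ(A)` iff some power `x^n` (`n ≥ 1`) is the image `ι(m)` of a lattice element
`m ∈ Φ₀(Y_A)` (`Φ(A)` = the perf-saturation of the image of `Φ₀(Y_A) → Φ₀^ℝ(Y_A)`, print's "`Φ_W` := the image of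
`Φ₀^pf`"). [cite: MochizukiEtTh2009, Def 3.6 p.76] -/
theorem mem_carrier_iff (hC : CarrierSpec d T C) {A : T.Dvᵒᵖ} (x : T'.ΦR.obj (C.baseOp A)) :
    x ∈ C.Φ.carrier A ↔ ∃ (n : ℕ+) (m : T'.Φ₀.obj (C.baseOp A)), T'.toR (C.baseOp A) m = x ^ (n : ℕ) := by
  rw [hC.Φ_carrier A]
  exact ⟨fun ⟨n, m, hm⟩ => ⟨n, m, hm⟩, fun ⟨n, m, hm⟩ => ⟨n, m, hm⟩⟩

/-- **S0 identifies `Φ(A)` with the perfection of the lattice**: there is a multiplicative equivalence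
`Ψ : Φ₀(Y_A)^pf ≃* Φ(A)` with `Ψ(a) = ι(a)` on `Φ₀(Y_A)` (so `Φ(f) ∘ Ψ = Ψ ∘ Φ₀(Y_f)^pf` by the naturality of
`Φ₀ → Φ₀^ℝ`) — from
`hC.Φ_carrier` and the compatible isomorphism `Φ₀^ℝ(Y_A) ≅ Φ₀(Y_A)^rlf` of the weak realification vocabulary
(`M^pf → M^rlf` injective, unique roots in `M^rlf`). [cite: MochizukiFrdI2008, Def. 2.4 (i) p.48] -/
theorem exists_mulEquiv_perfection (hC : CarrierSpec d T C) (A : T.Dvᵒᵖ) :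
    ∃ Ψ : Perfection (T'.Φ₀.obj (C.baseOp A)) ≃* C.Φ.carrier A,
      ∀ m : T'.Φ₀.obj (C.baseOp A), (Ψ (Perfection.of _ m)).1 = T'.toR (C.baseOp A) m := by
  obtain ⟨hM, e, he⟩ := (treeMonoidVocabWeak_isRealification _ _ _).mp (T'.isRealification (C.baseOp A))
  have hmem : ∀ b : Perfection (T'.Φ₀.obj (C.baseOp A)),
      (e.symm.toMonoidHom.comp hM.toRealification) b ∈ C.Φ.carrier A := by
    intro b
    obtain ⟨⟨m, n⟩, rfl⟩ := Perfection.mk_surjective b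
    refine (hC.mem_carrier_iff _).2 ⟨n, m, ?_⟩
    show T'.toR (C.baseOp A) m = e.symm (hM.toRealification (Perfection.mk m n)) ^ (n : ℕ)
    rw [← map_pow, ← map_pow, Perfection.mk_pow_self, ← he, MulEquiv.symm_apply_apply]
  let φ : Perfection (T'.Φ₀.obj (C.baseOp A)) →* C.Φ.carrier A :=
    (e.symm.toMonoidHom.comp hM.toRealification).codRestrict (C.Φ.carrier A) hmem
  have hφ_of : ∀ m : T'.Φ₀.obj (C.baseOp A),
      (φ (Perfection.of _ m)).1 = T'.toR (C.baseOp A) m := fun m => by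
    show e.symm (hM.toRealification (Perfection.of _ m)) = T'.toR (C.baseOp A) m
    rw [← he, MulEquiv.symm_apply_apply]
  have hφinj : Injective φ := by
    intro a b hab
    have h1 : hM.toRealification a = hM.toRealification b := e.symm.injective (congrArg Subtype.val hab)
    exact hM.factorMap_injective (congrArg Subtype.val h1)
  have hφsurj : Surjective φ := by
    rintro ⟨x, hx⟩
    obtain ⟨n, m, hm⟩ := (hC.mem_carrier_iff x).1 hx
    refine ⟨Perfection.mk m n, Subtype.ext ?_⟩
    show e.symm (hM.toRealification (Perfection.mk m n)) = x
    rw [MulEquiv.symm_apply_eq]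
    apply ((IsPerfFactorialWeak.Rlf.isPerfect hM).bijective_pow (n : ℕ) n.pos).1
    show hM.toRealification (Perfection.mk m n) ^ (n : ℕ) = e x ^ (n : ℕ)
    rw [← map_pow hM.toRealification, Perfection.mk_pow_self, ← map_pow e, ← hm, he]
  exact ⟨MulEquiv.ofBijective φ ⟨hφinj, hφsurj⟩, hφ_of⟩

/-- **The LATTICE → CARRIER transport of the pull dichotomy** (GA-08 for GA-12; RULINGS #339 (1)/(3)): if along every
endomorphism `f` of every object `A` of `𝒟_v̲` the lattice pull-back `Φ₀(Y_f) : Φ₀(Y_A) → Φ₀(Y_A)` is EITHER the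
identity OR carries some PRIMARY `m ∈ Φ₀(Y_A)` off itself (`¬ Φ₀(Y_f)(m) ≼ m`), then the carrier `Φ` of any `C`
satisfying S0 has the pull dichotomy `CarrierSpec.PullDichotomy C`: transport along `Ψ : Φ₀(Y_A)^pf ≃* Φ(A)`
(`exists_mulEquiv_perfection`) — the identity branch by unique roots in `Φ₀(Y_A)^pf`, the witness `Ψ(m) = ι(m)`
primary in `Φ(A)` (`Perfection.isPrimary_of_iff`, `IsPrimary.map_mulEquiv`) with `≼` reflected back to the lattice
(`precsim_map_iff`, `Perfection.of_precsim_of_iff`).  Stated over `C.baseOp A` / `C.base.map f.unop`: at a term with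
`C.base = 𝟭 T.Dv` definitionally, `h` is the dichotomy for `T'.Φ₀.map f` itself. [cite: MochizukiFrdI2008, Def. 1.1 (i) p.19] -/
theorem pullDichotomy_of_lattice (hC : CarrierSpec d T C)
    (h : ∀ (A : T.Dvᵒᵖ) (f : A ⟶ A),
      (∀ m : T'.Φ₀.obj (C.baseOp A), (T'.Φ₀.map (C.base.map f.unop).op).hom m = m) ∨
        ∃ m : T'.Φ₀.obj (C.baseOp A),
          IsPrimary m ∧ ¬ Precsim ((T'.Φ₀.map (C.base.map f.unop).op).hom m) m) :
    CarrierSpec.PullDichotomy C := by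
  intro A f
  obtain ⟨Ψ, hΨ⟩ := hC.exists_mulEquiv_perfection A
  obtain ⟨hM, -, -⟩ := (treeMonoidVocabWeak_isRealification _ _ _).mp (T'.isRealification (C.baseOp A))
  -- the pull-back read on the perfection of the lattice: `Ψ⁻¹ ∘ Φ(f) ∘ Ψ` is `Φ₀(Y_f)^pf`
  have hconj : ∀ m : T'.Φ₀.obj (C.baseOp A),
      Ψ.symm (C.Φ.pull f (Ψ (Perfection.of _ m))) =
        Perfection.of _ ((T'.Φ₀.map (C.base.map f.unop).op).hom m) := fun m => by
    rw [MulEquiv.symm_apply_eq]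
    apply Subtype.ext
    rw [SubMonoidOn.coe_pull, hΨ, hΨ]
    exact (T'.toR_natural (C.base.map f.unop).op m).symm
  rcases h A f with hid | ⟨m, hm, hnot⟩
  · refine Or.inl fun a => ?_
    obtain ⟨b, rfl⟩ := Ψ.surjective a
    obtain ⟨⟨m, n⟩, rfl⟩ := Perfection.mk_surjective b
    -- `Ψ⁻¹ ∘ Φ(f) ∘ Ψ` as an endomorphism of the perfect monoid `Φ₀(Y_A)^pf`: it fixes `a^{1/1}`, hence `a^{1/n}`
    let π : Perfection (T'.Φ₀.obj (C.baseOp A)) →* Perfection (T'.Φ₀.obj (C.baseOp A)) :=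
      Ψ.symm.toMonoidHom.comp ((C.Φ.pull f).comp Ψ.toMonoidHom)
    have hπ : ∀ x, π x = Ψ.symm (C.Φ.pull f (Ψ x)) := fun _ => rfl
    have hb : π (Perfection.mk m n) = Perfection.mk m n := by
      apply ((isPerfect_perfection (M := ↥(T'.Φ₀.obj (C.baseOp A)))).bijective_pow (n : ℕ) n.pos).1
      show π (Perfection.mk m n) ^ (n : ℕ) = Perfection.mk m n ^ (n : ℕ)
      rw [← map_pow, Perfection.mk_pow_self, hπ, hconj, hid]
    rw [hπ] at hb
    exact (MulEquiv.symm_apply_eq Ψ).1 hb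
  · refine Or.inr ⟨Ψ (Perfection.of _ m),
      ((Perfection.isPrimary_of_iff hM.isDivisorial.isSharp).2 hm).map_mulEquiv Ψ, fun hprec => hnot ?_⟩
    rw [(MulEquiv.symm_apply_eq Ψ).1 (hconj m)] at hprec
    exact Perfection.of_precsim_of_iff.1 ((precsim_map_iff Ψ).1 hprec)

end CarrierSpec

/-! ## Product lattices: the dichotomy on `N × M` from a dichotomy on the second factor

At GA-12's term the lattice is `Φ₀(U) = ord(𝒪^▷_{Ω^{aug U}}) × Div⁺(Z)^U` (`divisorMonoidsOf_Φ₀_obj`, constants FIRST)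
and the pull along an endomorphism is `(ord-part, phiZeroPull)` (`divisorMonoidsOf_Φ₀_map_apply`) with the `ord`-part
the IDENTITY (`GaloisValDatum.valuation_gal_eq`); so the hypothesis `h` of `CarrierSpec.pullDichotomy_of_lattice` is
the geometric `U`-orbit dichotomy (RULINGS #339 (1)) pushed through the two elementary lemmas below. -/

/-- In a product monoid `N × M` with `N` SHARP, `(1, m)` is primary as soon as `m` is primary in `M`: a non-trivial
`b = (b₁, b₂) ≼ (1, m)` has `b₁ ∣ 1`, so `b₁ = 1`, and `b₂ ≼ m`, so `m ≼ b₂` and `(1, m) ≼ b` ([FrdI] §0: primary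
elements, `≼`). [cite: MochizukiFrdI2008, §0 p.12] -/
theorem isPrimary_one_prod {N M : Type*} [CommMonoid N] [CommMonoid M] (hN : IsSharp N) {m : M}
    (hm : IsPrimary m) : IsPrimary ((1, m) : N × M) := by
  refine ⟨fun h => hm.1 (congrArg Prod.snd h), fun b hb hbm => ?_⟩
  obtain ⟨n, hn, c, hc⟩ := hbm
  have h1 : b.1 * c.1 = 1 := by rw [← Prod.fst_mul, ← hc, Prod.pow_fst, one_pow]
  have h2 : m ^ n = b.2 * c.2 := by rw [← Prod.snd_mul, ← hc, Prod.pow_snd]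
  have hb1 : b.1 = 1 := hN.eq_one_of_isUnit _ (IsUnit.of_mul_eq_one c.1 h1)
  have hb2 : b.2 ≠ 1 := fun hb2 => hb (Prod.ext hb1 hb2)
  obtain ⟨k, hk, e, he⟩ := hm.2 _ hb2 ⟨n, hn, c.2, h2⟩
  refine ⟨k, hk, (1, e), Prod.ext ?_ ?_⟩
  · simp only [Prod.pow_fst, Prod.fst_mul, hb1, one_pow, one_mul]
  · simpa only [Prod.pow_snd, Prod.snd_mul] using he

/-- **The dichotomy on a product lattice from the dichotomy on its second factor**: if an endomorphism `g` of `N × M`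
(`N` sharp) is the identity on the first coordinate and `φ` on the second, and `φ` is EITHER the identity OR carries a
primary `m` off itself, then `g` is either the identity or carries the primary `(1, m)` off itself. (The shape in which
GA-12 feeds the `U`-orbit dichotomy of `Div⁺(Z)^U` and the triviality of the pull on `ord(𝒪^▷_{Ω^{aug U}})` into
`CarrierSpec.pullDichotomy_of_lattice`.) [cite: MochizukiFrdI2008, Def. 1.1 (i) p.19] -/
theorem latticeDichotomy_prod_of_snd {N M : Type*} [CommMonoid N] [CommMonoid M] (hN : IsSharp N)
    (g : N × M →* N × M) (φ : M →* M) (hg : ∀ x, g x = (x.1, φ x.2))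
    (h : (∀ m, φ m = m) ∨ ∃ m, IsPrimary m ∧ ¬ Precsim (φ m) m) :
    (∀ x, g x = x) ∨ ∃ x, IsPrimary x ∧ ¬ Precsim (g x) x := by
  rcases h with hid | ⟨m, hm, hnot⟩
  · exact Or.inl fun x => by rw [hg, hid]
  · refine Or.inr ⟨(1, m), isPrimary_one_prod hN hm, fun hprec => hnot ?_⟩
    rw [hg] at hprec
    obtain ⟨n, hn, c, hc⟩ := hprec
    refine ⟨n, hn, c.2, ?_⟩
    simpa only [Prod.pow_snd, Prod.snd_mul] using congrArg Prod.snd hc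

/-- **D8 from the LATTICE dichotomy** (composition of `CarrierSpec.pullDichotomy_of_lattice` and
`isNonDilating_of_carrierSpec`): for a carrier satisfying S0, a dichotomy «identity, or a primary carried off itself»
for every lattice pull-back `Φ₀(Y_f)` makes `Φ` non-dilating at every object. [cite: MochizukiEtTh2009, Cor 3.8 (ii) p.80] -/
theorem isNonDilating_of_carrierSpec_of_lattice (hC : CarrierSpec d T C)
    (h : ∀ (A : T.Dvᵒᵖ) (f : A ⟶ A),
      (∀ m : T'.Φ₀.obj (C.baseOp A), (T'.Φ₀.map (C.base.map f.unop).op).hom m = m) ∨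
        ∃ m : T'.Φ₀.obj (C.baseOp A),
          IsPrimary m ∧ ¬ Precsim ((T'.Φ₀.map (C.base.map f.unop).op).hom m) m) :
    ∀ (A : T.Dvᵒᵖ) (f : A ⟶ A), treeMonoidVocabWeak.IsNonDilating (C.Φ.carrier A) (C.Φ.pull f) :=
  isNonDilating_of_carrierSpec hC (hC.pullDichotomy_of_lattice h)

end ArithThetaTower

end Literature.AnabelianGeometry.EtaleTheta
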